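import Summits.AtomisticToContinuum.Crystallization.Theorems.PalmUnimodularRigidityLayeredLawsSelectHcpPointShift

/-!
# Crux `LayeredLawsSelectHcp` (stmt-AtomisticToContinuum-9226), line `mtp-prestress-split-ergodic-frame`:
# the weighted mass-transport principle and shell-averaged re-rooting invariance

Registered sub-goal `tube_weightedTransport` of the crux item (lead c2, cycle 3).  It is the law-level engine of the
FRAME-FREE certificate architecture for the rigidity stub `stub_hcpTubeRigidity`: the law-level inequality
`E_P[h] − e(hcp a₀ h₀) ≥ κ·E_P[starDefect]` is to be proved as a POINTWISE inequality at the root modulo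
CORRECTORS — functionals of the rooted configuration whose `P`-expectation vanishes for every point-stationary `P`.
The correctors available without any chart or frame are exactly the ones produced here: for a point-stationary law
`P` (the crux's Mecke identity `PointStationary`, `−y` convention) carried by locally finite configurations, every
jointly measurable WEIGHT `w μ y ≥ 0` and every measurable `f ≥ 0`,

  `∫⁻ μ, ∫⁻ y, w μ y * f (θ_y μ) ∂μ ∂P = ∫⁻ μ, f μ * ∫⁻ y, w (θ_y μ) (−y) ∂μ ∂P`,   `θ_y μ = μ.map (· − y)`

("mass sent from the root with weights `w` and read through `f` at the receiver" = "mass received at the root"):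
Mecke with `g(μ, y) = w(μ, y) · f(θ_y μ)` and `θ_{−y} θ_y μ = μ`.  Consequences recorded here:
* `tube_setLIntegral_shift` — for a measurable window `W ⊆ ℝ³`, `E[∑_{y ∈ μ ∩ W} f(θ_y μ)] = E[f(μ) · μ(−W)]`; for a
  symmetric window (`−W = W`) the receiver count is `μ W` (`tube_setLIntegral_shift_symm`): shell-averaged re-rooting
  invariance `E[∑_{y ∈ shell} f(θ_y μ)] = E[f(μ) · #shell]`, with NO constancy of the shell count required — so
  `∑_{y ∈ shell} f(θ_y μ) − μ(shell) · f(μ)` is a zero-mean corrector for every shell and every `f`;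
* the nearest-neighbour instance is the one the certificate uses first (for hcp-charted laws the window
  `{0 < ‖y‖ ≤ 28/25}` holds exactly the twelve chart neighbours).
Joint measurability of `(μ, y) ↦ θ_y μ` on the Giry space is obtained, as in the landed point-shift lemma
(`tube_pointShift_invariance`, p115079), through the s-finite modification of the identity kernel on locally finite
configurations (`exists_isSFiniteKernel_apply_eq_self`, `measurable_map_sub_kernel`).
[cite: LastPenrose2017, Theorem 9.4 (mass-transport form of the Mecke equation); HevelingLast2005, §3]
-/

noncomputable section

open MeasureTheory ProbabilityTheory Set
open scoped ENNReal

namespace Summit.AtomisticToContinuum.Crystallization.Theorems.PalmUnimodularRigidity.LayeredLawsSelectHcp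

open Summit.AtomisticToContinuum.Crystallization.Theorems.LayeredLawsSelectHcp.Negative.DiracLaws (PointStationary)
open Summit.AtomisticToContinuum.Crystallization.Theorems.PalmUnimodularRigidity
  (exists_isSFiniteKernel_apply_eq_self measurable_map_sub_kernel measurableSet_floorNorm_preimage)

/-- **Registered sub-goal `tube_weightedTransport` — the weighted mass-transport principle.**  For a law `P` on
configurations `μ : Measure ℝ³` satisfying the crux's Mecke identity (`PointStationary`), almost surely locally
finite (finite mass on the norm shells `{⌊‖z‖⌋₊ = n}`), a jointly measurable weight `w ≥ 0` and a measurable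
`f ≥ 0`: `∫⁻ μ, ∫⁻ y, w μ y * f (θ_y μ) ∂μ ∂P = ∫⁻ μ, f μ * ∫⁻ y, w (θ_y μ) (−y) ∂μ ∂P`.
[cite: LastPenrose2017, Theorem 9.4] -/
theorem tube_weightedTransport :
    ∀ P : Measure (Measure (EuclideanSpace ℝ (Fin 3))), PointStationary P →
      (∀ᵐ μ ∂P, ∀ n : ℕ, μ ((fun z : (EuclideanSpace ℝ (Fin 3)) => ⌊‖z‖⌋₊) ⁻¹' {n}) < ⊤) →
      ∀ w : Measure (EuclideanSpace ℝ (Fin 3)) → (EuclideanSpace ℝ (Fin 3)) → ℝ≥0∞,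
        Measurable (Function.uncurry w) →
        ∀ f : Measure (EuclideanSpace ℝ (Fin 3)) → ℝ≥0∞, Measurable f →
          ∫⁻ μ, ∫⁻ y, w μ y * f (Measure.map (fun z => z - y) μ) ∂μ ∂P =
            ∫⁻ μ, f μ * ∫⁻ y, w (Measure.map (fun z => z - y) μ) (-y) ∂μ ∂P := by
  intro P hstat hlf w hw f hf
  -- an s-finite kernel agreeing with the identity on locally finite configurations
  obtain ⟨κ, hκ, hκid⟩ := exists_isSFiniteKernel_apply_eq_self
    (fun n : ℕ => (fun z : (EuclideanSpace ℝ (Fin 3)) => ⌊‖z‖⌋₊) ⁻¹' {n}) measurableSet_floorNorm_preimage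
    (fun i j hij => Set.disjoint_iff.2 fun z hz => hij (hz.1.symm.trans hz.2))
    (fun z => ⟨⌊‖z‖⌋₊, rfl⟩)
  -- the transport function `g(μ, y) = w(μ, y) · f(θ_y (κ μ))`
  set g : Measure (EuclideanSpace ℝ (Fin 3)) → (EuclideanSpace ℝ (Fin 3)) → ℝ≥0∞ :=
    fun μ y => w μ y * f ((κ μ).map (fun z => z - y)) with hg_def
  have hg : Measurable (Function.uncurry g) := by
    have : Function.uncurry g = fun p : Measure (EuclideanSpace ℝ (Fin 3)) × (EuclideanSpace ℝ (Fin 3)) =>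
        w p.1 p.2 * f ((κ p.1).map (fun z => z - p.2)) := by
      funext p; rfl
    rw [this]
    exact hw.mul (hf.comp (measurable_map_sub_kernel κ))
  have hMecke := hstat g hg
  -- LEFT: on locally finite `μ`, `κ μ = μ`
  have hL : ∫⁻ μ, ∫⁻ y, g μ y ∂μ ∂P = ∫⁻ μ, ∫⁻ y, w μ y * f (Measure.map (fun z => z - y) μ) ∂μ ∂P := by
    refine lintegral_congr_ae ?_
    filter_upwards [hlf] with μ hμ
    simp only [hg_def, hκid μ hμ]
  -- RIGHT: `θ_y μ` is locally finite, `κ (θ_y μ) = θ_y μ`, and `θ_{-y} θ_y μ = μ`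
  have hR : ∫⁻ μ, ∫⁻ y, g (Measure.map (fun z => z - y) μ) (-y) ∂μ ∂P =
      ∫⁻ μ, f μ * ∫⁻ y, w (Measure.map (fun z => z - y) μ) (-y) ∂μ ∂P := by
    refine lintegral_congr_ae ?_
    filter_upwards [hlf] with μ hμ
    have hpt : ∀ y, g (Measure.map (fun z => z - y) μ) (-y) =
        w (Measure.map (fun z => z - y) μ) (-y) * f μ := by
      intro y
      have hlfy := locallyFinite_map_sub hμ y
      simp only [hg_def, hκid _ hlfy, map_sub_neg_map_sub]
    -- measurability of `y ↦ w (θ_y μ) (-y)` for this fixed (locally finite) `μ`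
    have hθ : Measurable fun y : (EuclideanSpace ℝ (Fin 3)) => Measure.map (fun z => z - y) μ := by
      have h1 : Measurable fun y : (EuclideanSpace ℝ (Fin 3)) => (κ μ).map (fun z => z - y) :=
        (measurable_map_sub_kernel κ).comp (measurable_const.prodMk measurable_id)
      simpa only [hκid μ hμ] using h1
    have hwy : Measurable fun y : (EuclideanSpace ℝ (Fin 3)) => w (Measure.map (fun z => z - y) μ) (-y) :=
      hw.comp (hθ.prodMk measurable_neg)
    show ∫⁻ y, g (Measure.map (fun z => z - y) μ) (-y) ∂μ = f μ * ∫⁻ y, w (Measure.map (fun z => z - y) μ) (-y) ∂μ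
    simp_rw [hpt]
    rw [lintegral_mul_const _ hwy, mul_comm]
  rw [← hL, hMecke, hR]

/-- **Window transport**: for a measurable window `W ⊆ ℝ³`, the `P`-mean of `∑_{y ∈ μ ∩ W} f(θ_y μ)` (written as
`∫⁻ y in W, f (θ_y μ) ∂μ`) equals the `P`-mean of `f(μ) · μ(−W)`. [cite: LastPenrose2017, Theorem 9.4] -/
theorem tube_setLIntegral_shift {P : Measure (Measure (EuclideanSpace ℝ (Fin 3)))} (hstat : PointStationary P)
    (hlf : ∀ᵐ μ ∂P, ∀ n : ℕ, μ ((fun z : (EuclideanSpace ℝ (Fin 3)) => ⌊‖z‖⌋₊) ⁻¹' {n}) < ⊤)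
    {W : Set (EuclideanSpace ℝ (Fin 3))} (hW : MeasurableSet W)
    {f : Measure (EuclideanSpace ℝ (Fin 3)) → ℝ≥0∞} (hf : Measurable f) :
    ∫⁻ μ, ∫⁻ y in W, f (Measure.map (fun z => z - y) μ) ∂μ ∂P =
      ∫⁻ μ, f μ * μ ((fun y : (EuclideanSpace ℝ (Fin 3)) => -y) ⁻¹' W) ∂P := by
  have hw : Measurable (Function.uncurry fun (_ : Measure (EuclideanSpace ℝ (Fin 3)))
      (y : (EuclideanSpace ℝ (Fin 3))) => W.indicator (fun _ => (1 : ℝ≥0∞)) y) :=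
    (measurable_one.indicator hW).comp measurable_snd
  have h := tube_weightedTransport P hstat hlf (fun _ y => W.indicator (fun _ => (1 : ℝ≥0∞)) y) hw f hf
  have hl : ∀ μ : Measure (EuclideanSpace ℝ (Fin 3)),
      ∫⁻ y, W.indicator (fun _ => (1 : ℝ≥0∞)) y * f (Measure.map (fun z => z - y) μ) ∂μ =
      ∫⁻ y in W, f (Measure.map (fun z => z - y) μ) ∂μ := by
    intro μ
    rw [← lintegral_indicator hW]
    refine lintegral_congr fun y => ?_
    by_cases hy : y ∈ W <;> simp [hy]
  have hr : ∀ μ : Measure (EuclideanSpace ℝ (Fin 3)),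
      ∫⁻ y, W.indicator (fun _ => (1 : ℝ≥0∞)) (-y) ∂μ = μ ((fun y : (EuclideanSpace ℝ (Fin 3)) => -y) ⁻¹' W) := by
    intro μ
    have : (fun y : (EuclideanSpace ℝ (Fin 3)) => W.indicator (fun _ => (1 : ℝ≥0∞)) (-y)) =
        ((fun y : (EuclideanSpace ℝ (Fin 3)) => -y) ⁻¹' W).indicator (fun _ => (1 : ℝ≥0∞)) := by
      funext y
      by_cases hy : -y ∈ W
      · rw [Set.indicator_of_mem hy,
          Set.indicator_of_mem (show y ∈ (fun y : (EuclideanSpace ℝ (Fin 3)) => -y) ⁻¹' W from hy)]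
      · rw [Set.indicator_of_notMem hy,
          Set.indicator_of_notMem (show y ∉ (fun y : (EuclideanSpace ℝ (Fin 3)) => -y) ⁻¹' W from hy)]
    rw [this, lintegral_indicator (measurable_neg hW), setLIntegral_const, one_mul]
  simp_rw [hl, hr] at h
  exact h

/-- **Shell-averaged re-rooting invariance**: for a SYMMETRIC measurable window (`−W = W`, e.g. a norm shell
`{r₁ < ‖y‖ ≤ r₂}`), `E[∑_{y ∈ μ ∩ W} f(θ_y μ)] = E[f(μ) · μ(W)]` — so `∑_{y ∈ μ ∩ W} f(θ_y μ) − μ(W)·f(μ)` is a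
zero-mean corrector for every window and every `f`, with no constancy of the count `μ(W)` needed.
[cite: LastPenrose2017, Theorem 9.4] -/
theorem tube_setLIntegral_shift_symm {P : Measure (Measure (EuclideanSpace ℝ (Fin 3)))} (hstat : PointStationary P)
    (hlf : ∀ᵐ μ ∂P, ∀ n : ℕ, μ ((fun z : (EuclideanSpace ℝ (Fin 3)) => ⌊‖z‖⌋₊) ⁻¹' {n}) < ⊤)
    {W : Set (EuclideanSpace ℝ (Fin 3))} (hW : MeasurableSet W)
    (hsymm : (fun y : (EuclideanSpace ℝ (Fin 3)) => -y) ⁻¹' W = W)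
    {f : Measure (EuclideanSpace ℝ (Fin 3)) → ℝ≥0∞} (hf : Measurable f) :
    ∫⁻ μ, ∫⁻ y in W, f (Measure.map (fun z => z - y) μ) ∂μ ∂P = ∫⁻ μ, f μ * μ W ∂P := by
  rw [tube_setLIntegral_shift hstat hlf hW hf, hsymm]

/-- The norm shells `{r₁ < ‖y‖ ≤ r₂}` are symmetric measurable windows. [folklore] -/
theorem normShell_symm (r₁ r₂ : ℝ) :
    (fun y : (EuclideanSpace ℝ (Fin 3)) => -y) ⁻¹' {y : (EuclideanSpace ℝ (Fin 3)) | r₁ < ‖y‖ ∧ ‖y‖ ≤ r₂} =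
      {y : (EuclideanSpace ℝ (Fin 3)) | r₁ < ‖y‖ ∧ ‖y‖ ≤ r₂} := by
  ext y; simp [norm_neg]

/-- The norm shells are measurable. [folklore] -/
theorem measurableSet_normShell (r₁ r₂ : ℝ) :
    MeasurableSet {y : (EuclideanSpace ℝ (Fin 3)) | r₁ < ‖y‖ ∧ ‖y‖ ≤ r₂} :=
  (measurableSet_lt measurable_const measurable_norm).inter (measurableSet_le measurable_norm measurable_const)

/-- **Nearest-neighbour transport** (the instance the certificate uses first): with the crux's bond window
`{0 < ‖y‖ ≤ 28/25}`, `E[∑_{y ∈ NN(μ)} f(θ_y μ)] = E[f(μ) · #NN(μ)]`; for hcp-charted laws `#NN = 12` a.s.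
[cite: LastPenrose2017, Theorem 9.4] -/
theorem tube_nnTransport {P : Measure (Measure (EuclideanSpace ℝ (Fin 3)))} (hstat : PointStationary P)
    (hlf : ∀ᵐ μ ∂P, ∀ n : ℕ, μ ((fun z : (EuclideanSpace ℝ (Fin 3)) => ⌊‖z‖⌋₊) ⁻¹' {n}) < ⊤)
    {f : Measure (EuclideanSpace ℝ (Fin 3)) → ℝ≥0∞} (hf : Measurable f) :
    ∫⁻ μ, ∫⁻ y in {y : (EuclideanSpace ℝ (Fin 3)) | 0 < ‖y‖ ∧ ‖y‖ ≤ 28 / 25},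
        f (Measure.map (fun z => z - y) μ) ∂μ ∂P =
      ∫⁻ μ, f μ * μ {y : (EuclideanSpace ℝ (Fin 3)) | 0 < ‖y‖ ∧ ‖y‖ ≤ 28 / 25} ∂P :=
  tube_setLIntegral_shift_symm hstat hlf (measurableSet_normShell 0 (28 / 25)) (normShell_symm 0 (28 / 25)) hf

end Summit.AtomisticToContinuum.Crystallization.Theorems.PalmUnimodularRigidity.LayeredLawsSelectHcp

end
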